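import Literature.RingTheory.FormalGroups.FormalOModuleBudCoeff
import HarnessLib

/-!
# Buds of formal `𝒪`-module laws, V: the degree-`m` coefficients of the four variations
# ([Lazard 1955] §II Lemme 2–3; [Drinfeld 1974] §1 proof of Prop. 1.4)

Topic `Literature/RingTheory/FormalGroups`; namespace `Literature.RingTheory.FormalGroups`.  Fully proved theorems; no
definition, no named fact, no instance, no notation, no `sorry`.  Cell `hodgecm-mathlib`, P6 «MOD programme», sub-line P6d.

With `γ_j = degCoeff m Γ j` and `θ_m = [X^m]θ` (sibling `FormalOModuleBudCoeff`), for `Γ`, `θ` of order `≥ m`: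
* `coeff_assocVar` — `[Y₀^iY₁^jY₂^k] assocVar Γ = [k=0]γ_i + C(i+j,i)γ_{i+j} − [i=0]γ_j − C(j+k,j)γ_i` (`i+j+k = m`): the
  NEGATIVE of the relation defining `IsSymmCocycle` (sibling `CocyclePolynomial`);
* `coeff_commDefect` — `γ_j − γ_{m−j}`;
* `coeff_homVar` — `(C(m,j) − [j=0] − [j=m])·θ_m + (c − c^m)·γ_j`;
* `coeff_addVar` — `θ^{ab}_m − θ^a_m − θ^b_m − Σ_j c_a^j c_b^{m−j} γ_j`;
* `coeff_mulVar` — `θ^{ab}_m − c_a·θ^b_m − c_b^m·θ^a_m`.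
These are Lazard's ∕ Drinfeld's relations; the identification with `IsSymmCocycle` ∕ `IsDrinfeldCocycle` is the sibling
`FormalOModuleBudCocycle`.
-/

noncomputable section

namespace Literature.RingTheory.FormalGroups

open MvPowerSeries (HasSubst subst X order coeff monomial)
open Finset Finsupp

universe v

variable {B : Type v} [CommRing B]

/-! ## §3 The degree-`m` coefficients of the variations -/

section Coefficients

variable {m : ℕ} {Γ : MvPowerSeries (Fin 2) B}

/-- A sum over `range (m+1)` against an indicator of `j' = i` (`i ≤ m`). [folklore] -/
private theorem sum_mul_ite_eq (f : ℕ → B) {i : ℕ} (hi : i ≤ m) (c : B) :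
    ∑ j' ∈ range (m + 1), f j' * (if j' = i then c else 0) = f i * c := by
  rw [Finset.sum_eq_single i]
  · rw [if_pos rfl]
  · intro j' _ hj'; rw [if_neg hj', mul_zero]
  · intro h; exact absurd (Finset.mem_range.2 (by omega)) h

/-- The degree of `Y₀^iY₁^jY₂^k`. [folklore] -/
private theorem degree_fin3 (i j k : ℕ) : (single (0 : Fin 3) i + single 1 j + single 2 k).degree = i + j + k := by
  simp [map_add, degree_single]

/-- The degree of `X₀^jX₁^l`. [folklore] -/
private theorem degree_fin2 (j l : ℕ) : (single (0 : Fin 2) j + single 1 l).degree = j + l := by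
  simp [map_add, degree_single]

/-- **Coefficients of the associativity variation**: for `Γ` of order `≥ m` and `i + j + k = m`,
`[Y₀^iY₁^jY₂^k] assocVar Γ = [k=0]·γ_i + C(i+j,i)·γ_{i+j} − [i=0]·γ_j − C(j+k,j)·γ_i` (`γ = degCoeff m Γ`) — the negative of
Lazard's cocycle relation. [cite: Lazard1955, §II Lemme 2] -/
theorem coeff_assocVar (hΓ : (m : ℕ∞) ≤ Γ.order) {i j k : ℕ} (h : i + j + k = m) :
    coeff (single 0 i + single 1 j + single 2 k) (assocVar Γ) =
      (if k = 0 then degCoeff m Γ i else 0) + ((i + j).choose i : B) * degCoeff m Γ (i + j)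
        - (if i = 0 then degCoeff m Γ j else 0) - ((j + k).choose j : B) * degCoeff m Γ i := by
  have hd : (single (0 : Fin 3) i + single 1 j + single 2 k).degree = m := by rw [degree_fin3, h]
  have hX : ∀ s : Fin 3, MvPowerSeries.constantCoeff (X s : MvPowerSeries (Fin 3) B) = 0 := fun s =>
    MvPowerSeries.constantCoeff_X s
  have h01 : ∀ s, MvPowerSeries.constantCoeff ((![X 0, X 1] : Fin 2 → MvPowerSeries (Fin 3) B) s) = 0 := fun s => by
    fin_cases s <;> simp
  have h012 : ∀ s, MvPowerSeries.constantCoeff ((![X 0 + X 1, X 2] : Fin 2 → MvPowerSeries (Fin 3) B) s) = 0 := fun s => by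
    fin_cases s <;> simp
  have h12 : ∀ s, MvPowerSeries.constantCoeff ((![X 1, X 2] : Fin 2 → MvPowerSeries (Fin 3) B) s) = 0 := fun s => by
    fin_cases s <;> simp
  have h0_12 : ∀ s, MvPowerSeries.constantCoeff ((![X 0, X 1 + X 2] : Fin 2 → MvPowerSeries (Fin 3) B) s) = 0 := fun s => by
    fin_cases s <;> simp
  rw [assocVar, map_sub, map_sub, map_add, coeff_subst_eq_sum_of_le_order hΓ h01 hd,
    coeff_subst_eq_sum_of_le_order hΓ h012 hd, coeff_subst_eq_sum_of_le_order hΓ h12 hd,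
    coeff_subst_eq_sum_of_le_order hΓ h0_12 hd]
  simp only [Matrix.cons_val_zero, Matrix.cons_val_one, Matrix.cons_val_fin_one]
  -- term 1: `Γ(Y₀,Y₁)`
  have T1 : ∑ j' ∈ range (m + 1), degCoeff m Γ j' * coeff (single 0 i + single 1 j + single 2 k)
      ((X 0 : MvPowerSeries (Fin 3) B) ^ j' * X 1 ^ (m - j')) = if k = 0 then degCoeff m Γ i else 0 := by
    simp_rw [coeff_X_zero_pow_mul_X_one_pow_fin_three]
    have e2 : ∀ j' ∈ range (m + 1), degCoeff m Γ j' * (if j' = i ∧ m - j' = j ∧ 0 = k then (1 : B) else 0) =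
        degCoeff m Γ j' * (if j' = i then (if k = 0 then 1 else 0) else 0) := fun j' _ => by
      congr 1
      split_ifs <;> first | rfl | (exfalso; omega)
    rw [Finset.sum_congr rfl e2, sum_mul_ite_eq _ (by omega)]
    split_ifs <;> simp
  -- term 2: `Γ(Y₀+Y₁,Y₂)`
  have T2 : ∑ j' ∈ range (m + 1), degCoeff m Γ j' * coeff (single 0 i + single 1 j + single 2 k)
      (((X 0 : MvPowerSeries (Fin 3) B) + X 1) ^ j' * X 2 ^ (m - j')) = ((i + j).choose i : B) * degCoeff m Γ (i + j) := by
    simp_rw [coeff_add_pow_mul_X_pow_fin_three]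
    have e2 : ∀ j' ∈ range (m + 1), degCoeff m Γ j' * (if j' = i + j ∧ m - j' = k then ((i + j).choose i : B) else 0) =
        degCoeff m Γ j' * (if j' = i + j then ((i + j).choose i : B) else 0) := fun j' _ => by
      congr 1
      split_ifs <;> first | rfl | (exfalso; omega)
    rw [Finset.sum_congr rfl e2, sum_mul_ite_eq _ (by omega), mul_comm]
  -- term 3: `Γ(Y₁,Y₂)`
  have T3 : ∑ j' ∈ range (m + 1), degCoeff m Γ j' * coeff (single 0 i + single 1 j + single 2 k)
      ((X 1 : MvPowerSeries (Fin 3) B) ^ j' * X 2 ^ (m - j')) = if i = 0 then degCoeff m Γ j else 0 := by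
    simp_rw [coeff_X_one_pow_mul_X_two_pow_fin_three]
    have e2 : ∀ j' ∈ range (m + 1), degCoeff m Γ j' * (if 0 = i ∧ j' = j ∧ m - j' = k then (1 : B) else 0) =
        degCoeff m Γ j' * (if j' = j then (if i = 0 then 1 else 0) else 0) := fun j' _ => by
      congr 1
      split_ifs <;> first | rfl | (exfalso; omega)
    rw [Finset.sum_congr rfl e2, sum_mul_ite_eq _ (by omega)]
    split_ifs <;> simp
  -- term 4: `Γ(Y₀,Y₁+Y₂)`
  have T4 : ∑ j' ∈ range (m + 1), degCoeff m Γ j' * coeff (single 0 i + single 1 j + single 2 k)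
      ((X 0 : MvPowerSeries (Fin 3) B) ^ j' * (X 1 + X 2) ^ (m - j')) = ((j + k).choose j : B) * degCoeff m Γ i := by
    simp_rw [coeff_X_pow_mul_add_pow_fin_three]
    have e2 : ∀ j' ∈ range (m + 1), degCoeff m Γ j' * (if j' = i ∧ m - j' = j + k then ((j + k).choose j : B) else 0) =
        degCoeff m Γ j' * (if j' = i then ((j + k).choose j : B) else 0) := fun j' _ => by
      congr 1
      split_ifs <;> first | rfl | (exfalso; omega)
    rw [Finset.sum_congr rfl e2, sum_mul_ite_eq _ (by omega), mul_comm]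
  rw [T1, T2, T3, T4]

/-- **Coefficients of the commutativity defect**: for `Γ` of order `≥ m` and `j ≤ m`,
`[X₀^jX₁^{m−j}] commDefect Γ = γ_j − γ_{m−j}`. [cite: Lazard1955, §II Lemme 2] -/
theorem coeff_commDefect (hΓ : (m : ℕ∞) ≤ Γ.order) {j : ℕ} (hj : j ≤ m) :
    coeff (single 0 j + single 1 (m - j)) (commDefect Γ) = degCoeff m Γ j - degCoeff m Γ (m - j) := by
  have hd : (single (0 : Fin 2) j + single 1 (m - j)).degree = m := by rw [degree_fin2]; omega
  have h10 : ∀ s, MvPowerSeries.constantCoeff ((![X 1, X 0] : Fin 2 → MvPowerSeries (Fin 2) B) s) = 0 := fun s => by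
    fin_cases s <;> simp
  rw [commDefect, map_sub, coeff_subst_eq_sum_of_le_order hΓ h10 hd, degCoeff_of_le Γ hj]
  simp only [Matrix.cons_val_zero, Matrix.cons_val_one, Matrix.cons_val_fin_one]
  congr 1
  have e : ∀ j', (X 1 : MvPowerSeries (Fin 2) B) ^ j' * X 0 ^ (m - j') = X 0 ^ (m - j') * X 1 ^ j' := fun j' => mul_comm _ _
  simp_rw [e, coeff_X_pow_mul_X_pow_fin_two]
  have e2 : ∀ j' ∈ range (m + 1), degCoeff m Γ j' * (if m - j' = j ∧ j' = m - j then (1 : B) else 0) =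
      degCoeff m Γ j' * (if j' = m - j then 1 else 0) := fun j' _ => by
    congr 1
    split_ifs <;> first | rfl | (exfalso; omega)
  rw [Finset.sum_congr rfl e2, sum_mul_ite_eq _ (by omega), mul_one]

/-- **Coefficients of the homomorphism variation**: for `Γ`, `θ` of order `≥ m` and `j ≤ m`,
`[X₀^jX₁^{m−j}] homVar c Γ θ = (C(m,j) − [j=0] − [j=m])·θ_m + (c − c^m)·γ_j`. [cite: Drinfeld1974, §1 Prop. 1.4 (proof)] -/
theorem coeff_homVar (hΓ : (m : ℕ∞) ≤ Γ.order) {θ : PowerSeries B} (hθ : (m : ℕ∞) ≤ MvPowerSeries.order θ) (c : B)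
    {j : ℕ} (hj : j ≤ m) :
    coeff (single 0 j + single 1 (m - j)) (homVar c Γ θ) =
      ((m.choose j : B) - (if j = 0 then 1 else 0) - (if j = m then 1 else 0)) * PowerSeries.coeff m θ
        + (c - c ^ m) * degCoeff m Γ j := by
  have hd : (single (0 : Fin 2) j + single 1 (m - j)).degree = m := by rw [degree_fin2]; omega
  have hX : ∀ s : Fin 2, MvPowerSeries.constantCoeff (X s : MvPowerSeries (Fin 2) B) = 0 := fun s =>
    MvPowerSeries.constantCoeff_X s
  have hc : ∀ s, MvPowerSeries.constantCoeff ((![c • X 0, c • X 1] : Fin 2 → MvPowerSeries (Fin 2) B) s) = 0 := fun s => by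
    fin_cases s <;> simp
  rw [homVar, map_sub, map_sub, map_sub, map_add, coeff_psubst_eq_of_le_order hθ (by simp) hd,
    coeff_psubst_eq_of_le_order hθ (hX 0) hd, coeff_psubst_eq_of_le_order hθ (hX 1) hd, MvPowerSeries.coeff_smul,
    coeff_subst_eq_sum_of_le_order hΓ hc hd, ← degCoeff_of_le Γ hj, coeff_add_pow_fin_two, if_pos (by omega)]
  simp only [Matrix.cons_val_zero, Matrix.cons_val_one, Matrix.cons_val_fin_one]
  have eX0 : coeff (single 0 j + single 1 (m - j)) ((X 0 : MvPowerSeries (Fin 2) B) ^ m) = if j = m then 1 else 0 := by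
    have e : (X 0 : MvPowerSeries (Fin 2) B) ^ m = X 0 ^ m * X 1 ^ 0 := by rw [pow_zero, mul_one]
    rw [e, coeff_X_pow_mul_X_pow_fin_two]
    split_ifs <;> first | rfl | (exfalso; omega)
  have eX1 : coeff (single 0 j + single 1 (m - j)) ((X 1 : MvPowerSeries (Fin 2) B) ^ m) = if j = 0 then 1 else 0 := by
    have e : (X 1 : MvPowerSeries (Fin 2) B) ^ m = X 0 ^ 0 * X 1 ^ m := by rw [pow_zero, one_mul]
    rw [e, coeff_X_pow_mul_X_pow_fin_two]
    split_ifs <;> first | rfl | (exfalso; omega)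
  have eΓ : ∑ j' ∈ range (m + 1), degCoeff m Γ j' * coeff (single 0 j + single 1 (m - j))
      ((c • X 0 : MvPowerSeries (Fin 2) B) ^ j' * (c • X 1) ^ (m - j')) = c ^ m * degCoeff m Γ j := by
    have e : ∀ j' ∈ range (m + 1), degCoeff m Γ j' * coeff (single 0 j + single 1 (m - j))
        ((c • X 0 : MvPowerSeries (Fin 2) B) ^ j' * (c • X 1) ^ (m - j')) =
        degCoeff m Γ j' * (if j' = j then c ^ m else 0) := fun j' hj' => by
      rw [smul_pow, smul_pow, smul_mul_smul_comm, ← pow_add, Nat.add_sub_cancel' (Finset.mem_range_succ_iff.1 hj'),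
        MvPowerSeries.coeff_smul, coeff_X_pow_mul_X_pow_fin_two, mul_ite, mul_one, mul_zero]
      congr 1
      split_ifs <;> first | rfl | (exfalso; omega)
    rw [Finset.sum_congr rfl e, sum_mul_ite_eq _ hj, mul_comm]
  rw [show j + (m - j) = m by omega, eX0, eX1, eΓ]
  ring

/-- **Degree-`m` coefficient of the additivity variation**:
`[X^m] addVar c_a c_b Γ θ_a θ_b θ_{ab} = θ^{ab}_m − θ^a_m − θ^b_m − Σ_{j ≤ m} c_a^j c_b^{m−j} γ_j`. [cite: Drinfeld1974, §1 Prop. 1.4 (proof)] -/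
theorem coeff_addVar (hΓ : (m : ℕ∞) ≤ Γ.order) (ca cb : B) (θa θb θab : PowerSeries B) :
    PowerSeries.coeff m (addVar ca cb Γ θa θb θab) = PowerSeries.coeff m θab - PowerSeries.coeff m θa
      - PowerSeries.coeff m θb - ∑ j ∈ range (m + 1), ca ^ j * cb ^ (m - j) * degCoeff m Γ j := by
  have hd : (single () m).degree = m := by simp
  have hc : ∀ s, MvPowerSeries.constantCoeff ((![ca • (PowerSeries.X : PowerSeries B), cb • PowerSeries.X] :
      Fin 2 → MvPowerSeries Unit B) s) = 0 := fun s => by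
    fin_cases s <;> (change PowerSeries.constantCoeff (_ • PowerSeries.X) = 0; simp)
  rw [addVar, map_sub, map_sub, map_sub]
  congr 1
  rw [PowerSeries.coeff_def (s := single () m) (n := m) (by simp), coeff_subst_eq_sum_of_le_order hΓ hc hd]
  refine Finset.sum_congr rfl fun j' hj' => ?_
  simp only [Matrix.cons_val_zero, Matrix.cons_val_one, Matrix.cons_val_fin_one]
  rw [smul_pow, smul_pow, smul_mul_smul_comm, ← pow_add, Nat.add_sub_cancel' (Finset.mem_range_succ_iff.1 hj'),
    MvPowerSeries.coeff_smul, ← PowerSeries.coeff_def (s := single () m) (n := m) (by simp), PowerSeries.coeff_X_pow_self]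
  ring

/-- **Degree-`m` coefficient of the multiplicativity variation**:
`[X^m] mulVar c_a c_b θ_a θ_b θ_{ab} = θ^{ab}_m − c_a·θ^b_m − c_b^m·θ^a_m`. [cite: Drinfeld1974, §1 Prop. 1.4 (proof)] -/
theorem coeff_mulVar (ca cb : B) {θa : PowerSeries B} (hθa : (m : ℕ∞) ≤ MvPowerSeries.order θa) (θb θab : PowerSeries B) :
    PowerSeries.coeff m (mulVar ca cb θa θb θab) =
      PowerSeries.coeff m θab - ca * PowerSeries.coeff m θb - cb ^ m * PowerSeries.coeff m θa := by
  have hd : (single () m).degree = m := by simp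
  have hc : MvPowerSeries.constantCoeff (cb • (PowerSeries.X : PowerSeries B)) = 0 := by
    change PowerSeries.constantCoeff (cb • PowerSeries.X) = 0; simp
  rw [mulVar, map_sub, map_sub, PowerSeries.coeff_smul, PowerSeries.coeff_def (s := single () m) (n := m) (by simp),
    coeff_psubst_eq_of_le_order hθa hc hd, smul_pow, MvPowerSeries.coeff_smul,
    ← PowerSeries.coeff_def (s := single () m) (n := m) (by simp), PowerSeries.coeff_X_pow_self]
  ring

end Coefficients

end Literature.RingTheory.FormalGroups
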